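import Summits.HodgeConjecture.HodgeConjecture.Theorems.WeilTypeLadderSquareGerm
import Summits.HodgeConjecture.HodgeConjecture.Theorems.WeilTypeLadderBlochSeed
import Literature.AlgebraicGeometry.HodgeTheory.WeilClassesTensorBlochSeed
import HarnessLib

/-!
# WeilTypeLadder · DOOR T∘S: the Weil rungs from Deligne's family, Bloch's theorem and ONE seed predicate at tensor points

b2b cell `hweil` (packet `run/shared/lean/b2b/hodge-weil/`, LADDER `## CARVER v5` C33–C34, `## P2g5`). Prover 2,
generation 5 (variational chair). Nothing here is a new case of the Hodge conjecture and no named fact is introduced: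
the file COMPOSES, BY NAME,

* Deligne's family fact `deligne1982_weilFamily_hodgeWeilSection_all` (REFEREED source: Deligne, LNM 900, proof of
  Thm. 4.8; van Geemen, LNM 1594, 5.3–5.7 — packet G19) — the PEL family THROUGH the target with a flat `(k,k)` Weil
  section and a TENSOR POINT on the same base;
* Bloch's semiregularity theorem in class-level form `BlochSemiregularSpread (2k) k` (REFEREED: Bloch 1972 (7.4)/(7.5),
  Buchweitz–Flenner 2003 Thm. 5.2, Voisin LNM 1594 L7 Thm. 2.4; on-path: `blochSemiregularSpread_of_hodgeConjecture`);
* the DESIGN input `HasTensorBlochSeeds k d` (`Literature/…/WeilClassesTensorBlochSeed.lean`, this seat: at every tensor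
  point, for every hyperplane-type class `h` and every non-zero rational Weil class `x`, a Bloch-semiregular integral
  local complete intersection of codimension `k` carrying `q·hᵏ + x`; NOT implied by HC, no on-path lemma —
  Bloch, Remark (7.5)),

through the bridge `hasLocallyAlgebraicTensorAnchors_of_blochSpread_of_tensorBlochSeeds` (door T's local input TLOCAL
from Bloch seeds) and door T (`WeilTypeLadderTensorLocalAnchor(All).lean`), into:

1. `hasWeilSectionGermAtTensorPoints_of_blochSpread_of_tensorBlochSeeds` — SQGERM(k,d) (carver g5, C33 (a)) from Bloch
   seeds: the variational-Hodge GERM at the squares holds for classes carried by semiregular lci seeds.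
2. `weilClass_algebraic_of_deligneAll_of_blochSpread_of_tensorBlochSeeds` — class level, every `k ≥ 1`, `d ≥ 1`,
   every discriminant.
3. **stmt-HodgeConjecture-2524** `weilSixfolds_of_deligneAll_of_blochSpread_of_tensorBlochSeeds` — ALL `√-d`-Weil
   abelian SIXFOLDS ⟸ Deligne-all ∧ `BlochSemiregularSpread 6 3` ∧ `∀ d ≥ 1, HasTensorBlochSeeds 3 d`;
   R1′ `nonsplitSixfolds_…`; R∞ `weilClassesImaginaryQuadratic_…` (every `n ≥ 2`).
4. The two HeckePrymWeil cruxes by name: `weilSixfoldsSqrtMinus7_of_deligne_of_blochSpread_of_tensorBlochSeeds`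
   (stmt-HodgeConjecture-1260 ⟸ the route-sector Deligne fact ∧ Bloch(6,3) ∧ `HasTensorBlochSeeds 3 7`) and
   `weilTenfoldsSqrtMinus11_…` (⟸ Bloch(10,5) ∧ `HasTensorBlochSeeds 5 11`).
5. `doorTS_inputs_of_hodgeConjecture` — the two TRANSPORT inputs are on-path (HC ⟹ both); the seed input is the only
   one that is not.

WHY THIS DOOR (vs. doors A / B′ / S of `WeilTypeLadderBlochSeed.lean`): no reach fact (`weilFamilyReach_hyperbolic`,
`weilFamilyReach_similar`), no Weil-similarity, no discriminant bookkeeping and no floor F0a enter — Deligne's family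
passes through the target itself and its tensor point is where the seed lives; both transport inputs are refereed and
typed on real carriers. The price (module docstring of the Literature file): the seed must serve EVERY hyperplane-type
class of the tensor point, because an arbitrary family's only known global degree-2 classes are hyperplane classes of
its projective immersions. HONEST COUNT: rungs of the ladder proved unconditionally above the floor — still 0; what
this file changes is that the cell's "one remaining act" for stmt-2524 (LADDER C33 (d)) is now a single kernel
predicate, `∀ d ≥ 1, HasTensorBlochSeeds 3 d`, behind refereed transport only.

## References
* [Deligne1982HodgeCycles] P. Deligne, Hodge cycles on abelian varieties, LNM 900 (1982), proof of Thm. 4.8 (a)–(c).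
* [vanGeemen1994HodgeAV] B. van Geemen, LNM 1594 (1994), 5.3–5.11.
* [Bloch1972Semiregularity] S. Bloch, Invent. Math. 17 (1972), Thm. (7.4), Remark (7.5).
* [BuchweitzFlenner2003] R.-O. Buchweitz, H. Flenner, Compositio Math. 137 (2003), Thm. 5.2.
* [VoisinTorino1994] C. Voisin, LNM 1594, Lecture 7, Thm. 2.4.
* [Markman2025SecantWeil] E. Markman, arXiv:2502.03415 (UNREFEREED), §1.5 (shape `q·hᵏ + w` of an anchor class).
-/

-- every declaration of this problem lives in `Summit.HodgeConjecture.HodgeConjecture.…` (summit = sub-problem)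
set_option linter.dupNamespace false

noncomputable section

open CategoryTheory AlgebraicGeometry

namespace Summit.HodgeConjecture.HodgeConjecture.WeilTypeLadder

open Literature.AlgebraicGeometry Literature.AlgebraicGeometry.Motives
open Literature.AlgebraicGeometry.HodgeTheory
open Literature.AlgebraicTopology.SingularHomology

/-! ## 1. The germ at the squares from Bloch seeds -/

/-- **SQGERM(k,d) ⟸ Bloch's theorem (class level) ∧ tensor Bloch seeds** (`k, d ≥ 1`): the variational-Hodge germ at
the tensor points (`HasWeilSectionGermAtTensorPoints`, carver g5) holds as soon as every class `q·hᵏ + x` there is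
carried by a Bloch-semiregular integral local complete intersection — Bloch's theorem is exactly the germ statement for
such classes. [cite: Bloch1972Semiregularity, Thm. (7.4) and Remark (7.5)] [cite: BuchweitzFlenner2003, Thm. 5.2] -/
theorem hasWeilSectionGermAtTensorPoints_of_blochSpread_of_tensorBlochSeeds {k d : ℕ} (hk : 0 < k) (hd : 0 < d)
    (hB : BlochSemiregularSpread (2 * k) k) (hT : HasTensorBlochSeeds k d) :
    HasWeilSectionGermAtTensorPoints k d :=
  germ_of_hasLocallyAlgebraicTensorAnchors (hasLocallyAlgebraicTensorAnchors_of_blochSpread_of_tensorBlochSeeds hk hd hB hT)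

/-! ## 2. Class level: every rational `(k,k)` Weil class, every discriminant -/

/-- **Every rational `(k,k)` Weil class on every `√-d`-Weil abelian `2k`-fold `(X, Φ)` (`Φ ≫ Φ = -d`, ANY
discriminant) is algebraic, granting Deligne's all-`d` family fact, Bloch's theorem in class-level form in relative
dimension `2k` / codimension `k`, and tensor Bloch seeds in dimension `2k` for `K = ℚ(√-d)`** (`k, d ≥ 1`; hypotheses
BY NAME, nothing asserted). Door T (`weilClass_algebraic_of_deligneAll_of_tensorLocalAnchors`) with its local input
supplied by `hasLocallyAlgebraicTensorAnchors_of_blochSpread_of_tensorBlochSeeds`.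
[cite: Deligne1982HodgeCycles, proof of Thm. 4.8 (a)–(c)] [cite: Bloch1972Semiregularity, Thm. (7.4)] -/
theorem weilClass_algebraic_of_deligneAll_of_blochSpread_of_tensorBlochSeeds (d k : ℕ) (hd : 0 < d) (hk : 1 ≤ k)
    (hD : deligne1982_weilFamily_hodgeWeilSection_all) (hB : BlochSemiregularSpread (2 * k) k)
    (hT : HasTensorBlochSeeds k d) (X : AbelianVariety ℂ) (Φ : X ⟶ X) (hX : X.dim = 2 * k)
    (hΦ : Φ ≫ Φ = -((d : ℤ) • 𝟙 X)) (c : complexBetti X.X (2 * k)) (hcW : c ∈ weilClassesOf X Φ k d)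
    (hcr : IsRationalClass c) (hcH : IsOfHodgeType (2 * k) X.X (2 * k) k k c) :
    c ∈ algebraicClasses X.X k :=
  weilClass_algebraic_of_deligneAll_of_tensorLocalAnchors d k hd hk hD
    (hasLocallyAlgebraicTensorAnchors_of_blochSpread_of_tensorBlochSeeds (by omega) hd hB hT) X Φ hX hΦ c hcW hcr hcH

/-! ## 3. The rungs BY NAME -/

/-- **stmt-HodgeConjecture-2524 (`Theses.SevenfoldWeilCensus.WeilSixfolds`: ALL `√-d`-Weil abelian sixfolds, every
`d`, split AND non-split) ⟸ Deligne-all ∧ `BlochSemiregularSpread 6 3` ∧ tensor Bloch seeds in dimension 6 for every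
`d ≥ 1`** — both transport inputs refereed; the seed predicate the one design input (LADDER C33 (d) as a kernel
statement). [cite: Deligne1982HodgeCycles, proof of Thm. 4.8 (a)–(c)] [cite: Bloch1972Semiregularity, Thm. (7.4) and Remark (7.5)]
[cite: BuchweitzFlenner2003, Thm. 5.2] -/
theorem weilSixfolds_of_deligneAll_of_blochSpread_of_tensorBlochSeeds (hD : deligne1982_weilFamily_hodgeWeilSection_all)
    (hB : BlochSemiregularSpread 6 3) (hT : ∀ d : ℕ, 0 < d → HasTensorBlochSeeds 3 d) :
    Theses.SevenfoldWeilCensus.WeilSixfolds :=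
  weilSixfolds_of_deligneAll_of_tensorLocalAnchors hD
    fun d hd => hasLocallyAlgebraicTensorAnchors_of_blochSpread_of_tensorBlochSeeds (by norm_num) hd hB (hT d hd)

/-- **R1′ (`NonsplitSixfolds`) ⟸ Deligne-all ∧ `BlochSemiregularSpread 6 3` ∧ tensor Bloch seeds in dimension 6** —
the lowest open rung, BY NAME. [cite: Deligne1982HodgeCycles, proof of Thm. 4.8] [cite: Bloch1972Semiregularity, Thm. (7.4)] -/
theorem nonsplitSixfolds_of_deligneAll_of_blochSpread_of_tensorBlochSeeds (hD : deligne1982_weilFamily_hodgeWeilSection_all)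
    (hB : BlochSemiregularSpread 6 3) (hT : ∀ d : ℕ, 0 < d → HasTensorBlochSeeds 3 d) : NonsplitSixfolds :=
  nonsplitSixfolds_of_deligneAll_of_tensorLocalAnchors hD
    fun d hd => hasLocallyAlgebraicTensorAnchors_of_blochSpread_of_tensorBlochSeeds (by norm_num) hd hB (hT d hd)

/-- **R∞ (`WeilClassesImaginaryQuadratic`: every imaginary quadratic `K`, every dimension `2n ≥ 4`, every
discriminant) ⟸ Deligne-all ∧ Bloch's theorem in every relative dimension `2n` / codimension `n` ∧ tensor Bloch seeds
in every dimension** — BY NAME. [cite: Deligne1982HodgeCycles, proof of Thm. 4.8] [cite: Bloch1972Semiregularity, Thm. (7.4)]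
[cite: Weil1977HodgeRing, §3] -/
theorem weilClassesImaginaryQuadratic_of_deligneAll_of_blochSpread_of_tensorBlochSeeds
    (hD : deligne1982_weilFamily_hodgeWeilSection_all) (hB : ∀ n : ℕ, 2 ≤ n → BlochSemiregularSpread (2 * n) n)
    (hT : ∀ n : ℕ, 2 ≤ n → ∀ d : ℕ, 0 < d → HasTensorBlochSeeds n d) : WeilClassesImaginaryQuadratic :=
  weilClassesImaginaryQuadratic_of_deligneAll_of_tensorLocalAnchors hD fun n hn d hd =>
    hasLocallyAlgebraicTensorAnchors_of_blochSpread_of_tensorBlochSeeds (by omega) hd (hB n hn) (hT n hn d hd)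

/-! ## 4. The HeckePrymWeil cruxes BY NAME (route-sector Deligne fact, `p ≡ 3 (4)` prime) -/

/-- **Crux `HeckePrymWeil.WeilSixfoldsSqrtMinus7` (stmt-HodgeConjecture-1260) ⟸ `deligne1982_weilFamily_hodgeWeilSection`
∧ `BlochSemiregularSpread 6 3` ∧ `HasTensorBlochSeeds 3 7`** — the crux line `semiregular_clean_lci_six` of that item
(`weilSixfoldsSqrtMinus7_of_semiregularCleanLci`: Deligne family → clean semiregular lci on a tensor anchor → Bloch →
crux) in the ladder's spelling, with the seed quantified over hyperplane-type classes instead of a tensor-type clause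
on the anchor. [cite: Deligne1982HodgeCycles, proof of Thm. 4.8 (a)–(c)] [cite: Bloch1972Semiregularity, Thm. (7.4)] -/
theorem weilSixfoldsSqrtMinus7_of_deligne_of_blochSpread_of_tensorBlochSeeds
    (hD : deligne1982_weilFamily_hodgeWeilSection) (hB : BlochSemiregularSpread 6 3) (hT : HasTensorBlochSeeds 3 7) :
    Summit.HodgeConjecture.HodgeConjecture.Theses.HeckePrymWeil.WeilSixfoldsSqrtMinus7 :=
  weilSixfoldsSqrtMinus7_of_deligne_of_tensorLocalAnchors hD
    (hasLocallyAlgebraicTensorAnchors_of_blochSpread_of_tensorBlochSeeds (by norm_num) (by norm_num) hB hT)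

/-- **Crux `HeckePrymWeil.WeilTenfoldsSqrtMinus11` ⟸ `deligne1982_weilFamily_hodgeWeilSection` ∧
`BlochSemiregularSpread 10 5` ∧ `HasTensorBlochSeeds 5 11`.**
[cite: Deligne1982HodgeCycles, proof of Thm. 4.8 (a)–(c)] [cite: Bloch1972Semiregularity, Thm. (7.4)] -/
theorem weilTenfoldsSqrtMinus11_of_deligne_of_blochSpread_of_tensorBlochSeeds
    (hD : deligne1982_weilFamily_hodgeWeilSection) (hB : BlochSemiregularSpread 10 5) (hT : HasTensorBlochSeeds 5 11) :
    Summit.HodgeConjecture.HodgeConjecture.Theses.HeckePrymWeil.WeilTenfoldsSqrtMinus11 :=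
  weilTenfoldsSqrtMinus11_of_deligne_of_tensorLocalAnchors hD
    (hasLocallyAlgebraicTensorAnchors_of_blochSpread_of_tensorBlochSeeds (by norm_num) (by norm_num) hB hT)

/-! ## 5. What is on-path and what is not -/

/-- **The TRANSPORT inputs of door T∘S are cases of the Hodge conjecture**: under `HodgeConjecture` both
`BlochSemiregularSpread (2k) k` (`blochSemiregularSpread_of_hodgeConjecture`) and the local tensor clause itself
(`hasLocallyAlgebraicTensorAnchors_of_hodgeConjecture`) hold for every `k, d` — so of the three hypotheses of
`weilSixfolds_of_deligneAll_of_blochSpread_of_tensorBlochSeeds` only the seed predicate is not implied by the summit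
(it is a design input; Bloch, Remark (7.5)), and the reduction loses nothing on the transport side. [folklore] -/
theorem doorTS_transport_of_hodgeConjecture (hHC : _root_.HodgeConjecture) (k d : ℕ) :
    BlochSemiregularSpread (2 * k) k ∧ HasLocallyAlgebraicTensorAnchors k d :=
  ⟨blochSemiregularSpread_of_hodgeConjecture hHC (2 * k) k, hasLocallyAlgebraicTensorAnchors_of_hodgeConjecture hHC k d⟩

end Summit.HodgeConjecture.HodgeConjecture.WeilTypeLadder

end
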